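import Mathlib.Data.Matrix.Basis
import Mathlib.LinearAlgebra.Matrix.Trace
import Mathlib.LinearAlgebra.Matrix.Notation
import Mathlib.Tactic.LinearCombination
import Mathlib.Tactic.FinCases
import HarnessLib

/-!
# The SLODOWY DATA at a minimal nilpotent of `𝔤𝔩₃`: the model `N = c·E₀₂`, its `𝔰𝔩₂`-triple, the centraliser `𝔷(E₂₀)` of the opposite nilpotent,
# the transversal decomposition `M₃ = [N, M₃] ⊕ 𝔷(E₂₀)`, and the weights `(4,3,3,2)` of the contracting torus `ρ_t = t²·Ad(diag(t,1,t⁻¹))⁻¹`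

Topic `LinearAlgebra/Matrix`; namespace `Literature.LinearAlgebra.Matrix`.  THEOREMS ONLY (no definition, no instance, no notation, no named fact,
no `sorry`); Mathlib only.  Brick (D4d) of the `hodgecm-mathlib` cell's ROAD «HC-D»
(crux H413 = `stmt-HodgeConjecture-24833`; count-neutral): the coordinate data of the transverse (Slodowy) slice `S = N + 𝔷(N⁻)` at the minimal nilpotent
`N = c·E₀₂` (`0`-indexed entries; `c` a unit), used by the analytic brick D5(iii) («`|η|^{−1∕2}` is integrable near `N`»).  Everything is an ENTRYWISE
statement about `3 × 3` matrices over a commutative ring `R` (a field `K` with `2 ≠ 0` for the direct-sum decomposition); no `Submodule` lattice language,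
so that the consumer can build its linear equivalences in whichever currency it uses (`M₃(E)`, the trace-zero part, or the skew-hermitian `F`-form — all
three are stable under the maps below when `N`, `N⁻`, `diag(t,1,t⁻¹)` lie in them).

* §1 the triple: `single 0 2 c * single 0 2 c = 0`; `H := diagonal ![1, 0, −1]`; `⁅H, E₀₂⁆ = 2E₀₂`, `⁅H, E₂₀⁆ = −2E₂₀`, `⁅E₀₂, E₂₀⁆ = H` (as `A * B − B * A`).
* §2 CENTRALISERS: `Z * E₂₀ = E₂₀ * Z ↔ Z 0 1 = 0 ∧ Z 0 2 = 0 ∧ Z 1 2 = 0 ∧ Z 0 0 = Z 2 2` (`𝔷(N⁻)`, free entries `Z 0 0 = Z 2 2, Z 1 1, Z 1 0, Z 2 0, Z 2 1`);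
  `Z * E₀₂ = E₀₂ * Z ↔ Z 1 0 = 0 ∧ Z 2 0 = 0 ∧ Z 2 1 = 0 ∧ Z 0 0 = Z 2 2` (`𝔷(N)`).
* §3 `ad N`: the ENTRIES of `N * A − A * N` for `N = c·E₀₂` (`bracket_single_zero_two_apply`), its range `{M | M 1 0 = M 1 1 = M 2 0 = M 2 1 = 0, M 0 0 + M 2 2 = 0}`
  (membership of every bracket + an explicit preimage `A` supported on the complement `{A 1 0, A 2 0, A 2 1, A 2 2}` of `𝔷(N)`), injectivity of `ad N` on that
  complement.
* §4 TRANSVERSALITY (`2` a unit): every `Z` is UNIQUELY `(N * A − A * N) + W` with `W ∈ 𝔷(N⁻)`, with the explicit splitting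
  `W 0 0 = W 2 2 = ½(Z 0 0 + Z 2 2)`, `W 1 1 = Z 1 1`, `W i j = Z i j` below the diagonal; `range (ad N) ∩ 𝔷(N⁻) = 0`; for trace-free `Z` the part `W` is trace-free.
* §5 WEIGHTS: with `d t := diagonal ![t, 1, t⁻¹]` (`t` a unit) and `ρ_t Z := t² • (d t⁻¹ * Z * d t)`: `ρ_t (c·E₀₂) = c·E₀₂`, and on the basis of `𝔷(N⁻)`:
  `ρ_t E₂₀ = t⁴·E₂₀`, `ρ_t E₁₀ = t³·E₁₀`, `ρ_t E₂₁ = t³·E₂₁`, `ρ_t (diagonal v) = t²·diagonal v` (weights `4,3,3,2`, sum `12`); `ρ_t` preserves `𝔷(N⁻)`.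
  (The companion identity `Matrix.discr (ρ_t Z) = t¹² · Matrix.discr Z` lives with the discriminant calculus in the sibling file `CubicCharpolyDiscrNonRegular`.)
* §6 (ED. 2) the `θ`-STABLE complement `range (ad E₂₀)` of `𝔷(E₀₂)`: `single_two_zero_bracket_eq`, `bracket_single_two_zero_mem_range`, a section of `ad N` with values
  in `range (ad E₂₀)` (`exists_bracket_single_zero_two_eq_of_mem_range`, `c` and `2` units), injectivity there (`eq_zero_of_mem_range_of_bracket_eq_zero`), and the slice
  form of transversality `exists_mem_range_bracket_add_centralizer` (`Z = ⁅N, Y⁆ + W`, `Y ∈ range (ad N⁻)`, `W ∈ 𝔷(N⁻)`).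
* §7 (ED. 3) SLICE LOCUS (field, `2 ≠ 0`): `single_zero_two_add_ne_smul_one` (no scalar on the slice), `single_zero_two_add_mul_self_eq` (the square of a slice point,
  entrywise), `eq_zero_of_single_zero_two_add_sq_eq_zero` (the slice meets the
  square-zero locus only at the vertex), `ne_and_not_scalar_of_slice_nonregular` (on the trace-zero slice off the vertex, `(X − a•1)(X − b•1) = 0 ⇒ a ≠ b`, `X` non-scalar; `3 ≠ 0`).

## References
* [Humphreys1972] J. E. Humphreys, *Introduction to Lie Algebras and Representation Theory*, GTM 9 (1972), §7.2 (weights of `𝔰𝔩₂`-modules; the triple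
  `(x, h, y)`), §23.2 (invariant polynomials). Context locator; the transverse slice `e + 𝔷(f)` is P. Slodowy, *Simple Singularities and Simple Algebraic
  Groups*, LNM 815 (1980), §7.4 (not cited as a fact — everything here is an explicit matrix identity).
* [HornJohnson2013] R. A. Horn, C. R. Johnson, *Matrix Analysis*, 2nd ed. (2013), §0.9 (matrix units ∕ commutation). Context locator.
-/

set_option autoImplicit false

noncomputable section

open Matrix

namespace Literature.LinearAlgebra.Matrix

variable {R : Type*} [CommRing R]

/-! ## §1 The `𝔰𝔩₂`-triple through `E₀₂` -/

/-- `(c·E₀₂)² = 0`. [cite: Humphreys1972, §7.2] -/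
theorem single_zero_two_mul_self (c c' : R) : single (0 : Fin 3) (2 : Fin 3) c * single (0 : Fin 3) (2 : Fin 3) c' = 0 := by
  ext i j
  fin_cases i <;> fin_cases j <;> simp only [Matrix.mul_apply, Fin.sum_univ_three] <;> simp

/-- `⁅H, E₀₂⁆ = 2 E₀₂` with `H = diag(1, 0, −1)`. [cite: Humphreys1972, §7.2] -/
theorem diagonal_bracket_single_zero_two (c : R) :
    diagonal ![(1 : R), 0, -1] * single (0 : Fin 3) (2 : Fin 3) c - single (0 : Fin 3) (2 : Fin 3) c * diagonal ![(1 : R), 0, -1] =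
      (2 : R) • single (0 : Fin 3) (2 : Fin 3) c := by
  ext i j
  fin_cases i <;> fin_cases j <;> simp only [Matrix.sub_apply, Matrix.smul_apply, Matrix.mul_apply, Fin.sum_univ_three] <;> simp [two_mul]

/-- `⁅H, E₂₀⁆ = −2 E₂₀`. [cite: Humphreys1972, §7.2] -/
theorem diagonal_bracket_single_two_zero (c : R) :
    diagonal ![(1 : R), 0, -1] * single (2 : Fin 3) (0 : Fin 3) c - single (2 : Fin 3) (0 : Fin 3) c * diagonal ![(1 : R), 0, -1] =
      (-2 : R) • single (2 : Fin 3) (0 : Fin 3) c := by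
  ext i j
  fin_cases i <;> fin_cases j <;> simp only [Matrix.sub_apply, Matrix.smul_apply, Matrix.mul_apply, Fin.sum_univ_three] <;> simp [two_mul, sub_eq_add_neg]

/-- `⁅E₀₂, E₂₀⁆ = H`. [cite: Humphreys1972, §7.2] -/
theorem single_zero_two_bracket_single_two_zero :
    single (0 : Fin 3) (2 : Fin 3) (1 : R) * single (2 : Fin 3) (0 : Fin 3) 1 - single (2 : Fin 3) (0 : Fin 3) 1 * single (0 : Fin 3) (2 : Fin 3) 1 =
      diagonal ![(1 : R), 0, -1] := by
  ext i j
  fin_cases i <;> fin_cases j <;> simp only [Matrix.sub_apply, Matrix.mul_apply, Fin.sum_univ_three] <;> simp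

/-! ## §2 Centralisers of `E₂₀` and of `E₀₂` (entrywise) -/

/-- `𝔷(E₂₀)`: `Z` commutes with `E₂₀` iff `Z 0 1 = Z 0 2 = Z 1 2 = 0` and `Z 0 0 = Z 2 2`. [cite: HornJohnson2013, §0.9] -/
theorem commute_single_two_zero_iff (Z : Matrix (Fin 3) (Fin 3) R) :
    Z * single (2 : Fin 3) (0 : Fin 3) (1 : R) = single (2 : Fin 3) (0 : Fin 3) 1 * Z ↔
      Z 0 1 = 0 ∧ Z 0 2 = 0 ∧ Z 1 2 = 0 ∧ Z 0 0 = Z 2 2 := by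
  constructor
  · intro h
    have e := fun i j => congrFun (congrFun h i) j
    have e00 := e 0 0
    have e10 := e 1 0
    have e20 := e 2 0
    have e21 := e 2 1
    simp only [Matrix.mul_apply, Fin.sum_univ_three] at e00 e10 e20 e21
    simp at e00 e10 e20 e21
    exact ⟨e21.symm, e00, e10, e20.symm⟩
  · rintro ⟨h1, h2, h3, h4⟩
    ext i j
    fin_cases i <;> fin_cases j <;> simp only [Matrix.mul_apply, Fin.sum_univ_three] <;> simp [h1, h2, h3, h4]

/-- `𝔷(E₀₂)`: `Z` commutes with `c·E₀₂` (`c` a unit) iff `Z 1 0 = Z 2 0 = Z 2 1 = 0` and `Z 0 0 = Z 2 2`. [cite: HornJohnson2013, §0.9] -/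
theorem commute_single_zero_two_iff (Z : Matrix (Fin 3) (Fin 3) R) {c : R} (hc : IsUnit c) :
    Z * single (0 : Fin 3) (2 : Fin 3) c = single (0 : Fin 3) (2 : Fin 3) c * Z ↔
      Z 1 0 = 0 ∧ Z 2 0 = 0 ∧ Z 2 1 = 0 ∧ Z 0 0 = Z 2 2 := by
  constructor
  · intro h
    have e := fun i j => congrFun (congrFun h i) j
    have e02 := e 0 2
    have e12 := e 1 2
    have e22 := e 2 2
    have e00 := e 0 0
    have e01 := e 0 1
    simp only [Matrix.mul_apply, Fin.sum_univ_three] at e02 e12 e22 e00 e01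
    simp at e02 e12 e22 e00 e01
    refine ⟨hc.mul_left_eq_zero.mp e12, hc.mul_left_eq_zero.mp e22, hc.mul_right_eq_zero.mp e01.symm, ?_⟩
    exact hc.mul_right_cancel (e02.trans (mul_comm _ _))
  · rintro ⟨h1, h2, h3, h4⟩
    ext i j
    fin_cases i <;> fin_cases j <;> simp only [Matrix.mul_apply, Fin.sum_univ_three] <;> simp [h1, h2, h3, h4, mul_comm]

/-! ## §3 `ad N` for `N = c·E₀₂`: entries, range, a section -/

/-- ENTRIES of `⁅c·E₀₂, A⁆ = N A − A N`: row `0` receives `c ·` row `2` of `A`, column `2` loses `c ·` column `0` of `A`. [cite: HornJohnson2013, §0.9] -/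
theorem single_zero_two_bracket_eq (c : R) (A : Matrix (Fin 3) (Fin 3) R) :
    single (0 : Fin 3) (2 : Fin 3) c * A - A * single (0 : Fin 3) (2 : Fin 3) c =
      !![c * A 2 0, c * A 2 1, c * (A 2 2 - A 0 0); 0, 0, -(c * A 1 0); 0, 0, -(c * A 2 0)] := by
  ext i j
  fin_cases i <;> fin_cases j <;> simp only [Matrix.sub_apply, Matrix.mul_apply, Fin.sum_univ_three] <;> simp <;> ring

/-- RANGE of `ad N`: every bracket `M = ⁅c·E₀₂, A⁆` has `M 1 0 = M 1 1 = M 2 0 = M 2 1 = 0` and `M 0 0 + M 2 2 = 0`. [cite: HornJohnson2013, §0.9] -/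
theorem bracket_single_zero_two_mem_range (c : R) (A : Matrix (Fin 3) (Fin 3) R) :
    (single (0 : Fin 3) (2 : Fin 3) c * A - A * single (0 : Fin 3) (2 : Fin 3) c) 1 0 = 0 ∧
      (single (0 : Fin 3) (2 : Fin 3) c * A - A * single (0 : Fin 3) (2 : Fin 3) c) 1 1 = 0 ∧
      (single (0 : Fin 3) (2 : Fin 3) c * A - A * single (0 : Fin 3) (2 : Fin 3) c) 2 0 = 0 ∧
      (single (0 : Fin 3) (2 : Fin 3) c * A - A * single (0 : Fin 3) (2 : Fin 3) c) 2 1 = 0 ∧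
      (single (0 : Fin 3) (2 : Fin 3) c * A - A * single (0 : Fin 3) (2 : Fin 3) c) 0 0 +
        (single (0 : Fin 3) (2 : Fin 3) c * A - A * single (0 : Fin 3) (2 : Fin 3) c) 2 2 = 0 := by
  rw [single_zero_two_bracket_eq]
  refine ⟨?_, ?_, ?_, ?_, ?_⟩ <;> simp

/-- A SECTION of `ad N` on its range (`c` a unit): a matrix `M` with `M 1 0 = M 1 1 = M 2 0 = M 2 1 = 0`, `M 0 0 + M 2 2 = 0` is the bracket of `c·E₀₂` with the
explicit `A = c⁻¹ · (M 0 0 E₂₀ + M 0 1 E₂₁ + M 0 2 E₂₂ − M 1 2 E₁₀)` supported on the complement `{(1,0),(2,0),(2,1),(2,2)}` of `𝔷(E₀₂)`. [cite: HornJohnson2013, §0.9] -/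
theorem exists_bracket_single_zero_two_eq (c : Rˣ) {M : Matrix (Fin 3) (Fin 3) R}
    (h10 : M 1 0 = 0) (h11 : M 1 1 = 0) (h20 : M 2 0 = 0) (h21 : M 2 1 = 0) (htr : M 0 0 + M 2 2 = 0) :
    single (0 : Fin 3) (2 : Fin 3) (c : R) * !![0, 0, 0; -(↑c⁻¹ * M 1 2), 0, 0; ↑c⁻¹ * M 0 0, ↑c⁻¹ * M 0 1, ↑c⁻¹ * M 0 2] -
        !![0, 0, 0; -(↑c⁻¹ * M 1 2), 0, 0; ↑c⁻¹ * M 0 0, ↑c⁻¹ * M 0 1, ↑c⁻¹ * M 0 2] * single (0 : Fin 3) (2 : Fin 3) (c : R) = M := by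
  rw [single_zero_two_bracket_eq]
  ext i j
  fin_cases i <;> fin_cases j <;> simp [h10, h11, h20, h21]
  linear_combination (-1 : R) * htr

/-- INJECTIVITY of `ad N` on the complement of `𝔷(N)`: if `A` is supported on `{(1,0),(2,0),(2,1),(2,2)}` and `⁅c·E₀₂, A⁆ = 0` (`c` a unit) then `A = 0`.
[cite: HornJohnson2013, §0.9] -/
theorem eq_zero_of_bracket_single_zero_two_eq_zero {c : R} (hc : IsUnit c) {A : Matrix (Fin 3) (Fin 3) R}
    (h00 : A 0 0 = 0) (h01 : A 0 1 = 0) (h02 : A 0 2 = 0) (h11 : A 1 1 = 0) (h12 : A 1 2 = 0)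
    (h : single (0 : Fin 3) (2 : Fin 3) c * A - A * single (0 : Fin 3) (2 : Fin 3) c = 0) : A = 0 := by
  rw [single_zero_two_bracket_eq, h00, sub_zero] at h
  have e := fun i j => congrFun (congrFun h i) j
  have e00 := e 0 0
  have e01 := e 0 1
  have e02 := e 0 2
  have e12 := e 1 2
  simp at e00 e01 e02 e12
  have a20 : A 2 0 = 0 := hc.mul_right_eq_zero.mp e00
  have a21 : A 2 1 = 0 := hc.mul_right_eq_zero.mp e01
  have a22 : A 2 2 = 0 := hc.mul_right_eq_zero.mp e02
  have a10 : A 1 0 = 0 := hc.mul_right_eq_zero.mp e12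
  ext i j
  fin_cases i <;> fin_cases j <;> simp [h00, h01, h02, h11, h12, a20, a21, a22, a10]

/-! ## §4 Transversality `M₃ = range (ad N) ⊕ 𝔷(E₂₀)` (`2` a unit) -/

/-- EXISTENCE with the explicit splitting: `Z = ⁅c·E₀₂, A⁆ + W`, `W ∈ 𝔷(E₂₀)` with `W 0 0 = W 2 2 = ⅟2·(Z 0 0 + Z 2 2)`. [cite: Humphreys1972, §7.2] -/
theorem exists_bracket_add_centralizer (c : Rˣ) (h2 : IsUnit (2 : R)) (Z : Matrix (Fin 3) (Fin 3) R) :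
    ∃ A W : Matrix (Fin 3) (Fin 3) R,
      W * single (2 : Fin 3) (0 : Fin 3) (1 : R) = single (2 : Fin 3) (0 : Fin 3) 1 * W ∧
        Z = (single (0 : Fin 3) (2 : Fin 3) (c : R) * A - A * single (0 : Fin 3) (2 : Fin 3) (c : R)) + W ∧
        2 * W 0 0 = Z 0 0 + Z 2 2 ∧ W 2 2 = W 0 0 ∧ W 1 1 = Z 1 1 ∧
        W 1 0 = Z 1 0 ∧ W 2 0 = Z 2 0 ∧ W 2 1 = Z 2 1 := by
  obtain ⟨u, hu⟩ := h2
  have hu' : (↑u : R) * ↑u⁻¹ = 1 := Units.mul_inv u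
  have hu2 : (↑u : R) = 2 := hu
  refine ⟨!![0, 0, 0; -(↑c⁻¹ * Z 1 2), 0, 0; ↑c⁻¹ * (↑u⁻¹ * (Z 0 0 - Z 2 2)), ↑c⁻¹ * Z 0 1, ↑c⁻¹ * Z 0 2],
    !![↑u⁻¹ * (Z 0 0 + Z 2 2), 0, 0; Z 1 0, Z 1 1, 0; Z 2 0, Z 2 1, ↑u⁻¹ * (Z 0 0 + Z 2 2)], ?_, ?_, ?_, ?_, ?_, ?_, ?_, ?_⟩
  · ext i j
    fin_cases i <;> fin_cases j <;> simp only [Matrix.mul_apply, Fin.sum_univ_three] <;> simp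
  · rw [single_zero_two_bracket_eq]
    ext i j
    fin_cases i <;> fin_cases j <;> simp
    · linear_combination (-(Z 0 0)) * hu' + (Z 0 0 * ↑u⁻¹) * hu2
    · linear_combination (-(Z 2 2)) * hu' + (Z 2 2 * ↑u⁻¹) * hu2
  · simp only [Matrix.of_apply, Matrix.cons_val', Matrix.cons_val_zero, Matrix.empty_val']
    linear_combination (-(↑u⁻¹ * (Z 0 0 + Z 2 2))) * hu2 + (Z 0 0 + Z 2 2) * hu'
  · simp
  · simp
  · simp
  · simp
  · simp

/-- UNIQUENESS: `range (ad N) ∩ 𝔷(E₂₀) = 0` — a bracket `⁅c·E₀₂, A⁆` commuting with `E₂₀` vanishes (`2` a non-zero-divisor suffices; stated for `IsUnit 2`).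
[cite: Humphreys1972, §7.2] -/
theorem bracket_eq_zero_of_commute_single_two_zero (h2 : IsUnit (2 : R)) (c : R) (A : Matrix (Fin 3) (Fin 3) R)
    (hW : (single (0 : Fin 3) (2 : Fin 3) c * A - A * single (0 : Fin 3) (2 : Fin 3) c) * single (2 : Fin 3) (0 : Fin 3) (1 : R) =
      single (2 : Fin 3) (0 : Fin 3) 1 * (single (0 : Fin 3) (2 : Fin 3) c * A - A * single (0 : Fin 3) (2 : Fin 3) c)) :
    single (0 : Fin 3) (2 : Fin 3) c * A - A * single (0 : Fin 3) (2 : Fin 3) c = 0 := by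
  obtain ⟨u, hu⟩ := h2
  rw [single_zero_two_bracket_eq] at hW ⊢
  obtain ⟨h01, h02, h12, h0022⟩ := (commute_single_two_zero_iff _).mp hW
  simp at h01 h02 h12 h0022
  -- `h0022 : c * A 2 0 = -(c * A 2 0)` gives `2 • (c * A 2 0) = 0`, hence `c * A 2 0 = 0` since `2` is a unit
  have h : (↑u : R) * (c * A 2 0) = 0 := by
    rw [hu]
    linear_combination h0022
  have h20 : c * A 2 0 = 0 := (u.isUnit.mul_right_eq_zero).mp h
  ext i j
  fin_cases i <;> fin_cases j <;> simp [h01, h20]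
  · linear_combination h02
  · linear_combination h12

/-- The `𝔷(E₂₀)`-component of a TRACE-FREE matrix is trace-free (brackets are trace-free). [cite: Humphreys1972, §7.2] -/
theorem trace_eq_of_eq_bracket_add {Z A W N : Matrix (Fin 3) (Fin 3) R} (h : Z = (N * A - A * N) + W) : W.trace = Z.trace := by
  rw [h, Matrix.trace_add, Matrix.trace_sub, Matrix.trace_mul_comm, sub_self, zero_add]

/-! ## §5 The contracting torus `ρ_t = t²·Ad(diag(t,1,t⁻¹))⁻¹`: weights -/

/-- `ρ_t` FIXES `N`: `t² • (diag(t,1,t⁻¹)⁻¹ (c·E₀₂) diag(t,1,t⁻¹)) = c·E₀₂`. [cite: Humphreys1972, §7.2] -/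
theorem torus_conj_single_zero_two (t : Rˣ) (c : R) :
    ((t : R) ^ 2) • (diagonal ![(↑t⁻¹ : R), 1, ↑t] * single (0 : Fin 3) (2 : Fin 3) c * diagonal ![(↑t : R), 1, ↑t⁻¹]) =
      single (0 : Fin 3) (2 : Fin 3) c := by
  have ht' : (↑t : R) * ↑t⁻¹ = 1 := Units.mul_inv t
  ext i j
  fin_cases i <;> fin_cases j <;> simp only [Matrix.smul_apply, Matrix.mul_apply, Fin.sum_univ_three] <;> simp
  linear_combination (↑t * ↑t⁻¹ + 1) * c * ht'

/-- WEIGHT `4` on `E₂₀`. [cite: Humphreys1972, §7.2] -/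
theorem torus_conj_single_two_zero (t : Rˣ) (c : R) :
    ((t : R) ^ 2) • (diagonal ![(↑t⁻¹ : R), 1, ↑t] * single (2 : Fin 3) (0 : Fin 3) c * diagonal ![(↑t : R), 1, ↑t⁻¹]) =
      ((t : R) ^ 4) • single (2 : Fin 3) (0 : Fin 3) c := by
  ext i j
  fin_cases i <;> fin_cases j <;> simp only [Matrix.smul_apply, Matrix.mul_apply, Fin.sum_univ_three] <;> simp
  ring

/-- WEIGHT `3` on `E₁₀`. [cite: Humphreys1972, §7.2] -/
theorem torus_conj_single_one_zero (t : Rˣ) (c : R) :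
    ((t : R) ^ 2) • (diagonal ![(↑t⁻¹ : R), 1, ↑t] * single (1 : Fin 3) (0 : Fin 3) c * diagonal ![(↑t : R), 1, ↑t⁻¹]) =
      ((t : R) ^ 3) • single (1 : Fin 3) (0 : Fin 3) c := by
  ext i j
  fin_cases i <;> fin_cases j <;> simp only [Matrix.smul_apply, Matrix.mul_apply, Fin.sum_univ_three] <;> simp
  ring

/-- WEIGHT `3` on `E₂₁`. [cite: Humphreys1972, §7.2] -/
theorem torus_conj_single_two_one (t : Rˣ) (c : R) :
    ((t : R) ^ 2) • (diagonal ![(↑t⁻¹ : R), 1, ↑t] * single (2 : Fin 3) (1 : Fin 3) c * diagonal ![(↑t : R), 1, ↑t⁻¹]) =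
      ((t : R) ^ 3) • single (2 : Fin 3) (1 : Fin 3) c := by
  ext i j
  fin_cases i <;> fin_cases j <;> simp only [Matrix.smul_apply, Matrix.mul_apply, Fin.sum_univ_three] <;> simp
  ring

/-- WEIGHT `2` on the diagonal part of `𝔷(E₂₀)` (indeed on every diagonal matrix). [cite: Humphreys1972, §7.2] -/
theorem torus_conj_diagonal (t : Rˣ) (v : Fin 3 → R) :
    ((t : R) ^ 2) • (diagonal ![(↑t⁻¹ : R), 1, ↑t] * diagonal v * diagonal ![(↑t : R), 1, ↑t⁻¹]) = ((t : R) ^ 2) • diagonal v := by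
  have ht' : (↑t : R) * ↑t⁻¹ = 1 := Units.mul_inv t
  ext i j
  fin_cases i <;> fin_cases j <;> simp only [Matrix.smul_apply, Matrix.mul_apply, Fin.sum_univ_three] <;> simp
  · linear_combination (↑t ^ 2 * v 0) * ht'
  · linear_combination (↑t ^ 2 * v 2) * ht'

/-- `ρ_t` PRESERVES `𝔷(E₂₀)`. [cite: Humphreys1972, §7.2] -/
theorem torus_conj_commute_single_two_zero (t : Rˣ) {W : Matrix (Fin 3) (Fin 3) R}
    (hW : W * single (2 : Fin 3) (0 : Fin 3) (1 : R) = single (2 : Fin 3) (0 : Fin 3) 1 * W) :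
    (((t : R) ^ 2) • (diagonal ![(↑t⁻¹ : R), 1, ↑t] * W * diagonal ![(↑t : R), 1, ↑t⁻¹])) * single (2 : Fin 3) (0 : Fin 3) (1 : R) =
      single (2 : Fin 3) (0 : Fin 3) 1 * (((t : R) ^ 2) • (diagonal ![(↑t⁻¹ : R), 1, ↑t] * W * diagonal ![(↑t : R), 1, ↑t⁻¹])) := by
  have ht : (↑t⁻¹ : R) * ↑t = 1 := Units.inv_mul t
  have ht' : (↑t : R) * ↑t⁻¹ = 1 := Units.mul_inv t
  obtain ⟨h1, h2, h3, h4⟩ := (commute_single_two_zero_iff W).mp hW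
  rw [commute_single_two_zero_iff]
  refine ⟨?_, ?_, ?_, ?_⟩ <;> simp only [Matrix.smul_apply, Matrix.mul_apply, Fin.sum_univ_three] <;> simp [h1, h2, h3, h4]
  linear_combination (↑t ^ 2 * W 2 2) * ht - (↑t ^ 2 * W 2 2) * ht'

/-- The inverse pair: `diag(t,1,t⁻¹) * diag(t⁻¹,1,t) = 1` (so `ρ_t` is `t² • Ad(d_t)⁻¹` literally). [cite: HornJohnson2013, §0.9] -/
theorem torus_mul_torus_inv (t : Rˣ) :
    diagonal ![(↑t : R), 1, ↑t⁻¹] * diagonal ![(↑t⁻¹ : R), 1, ↑t] = 1 := by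
  ext i j
  fin_cases i <;> fin_cases j <;> simp only [Matrix.mul_apply, Fin.sum_univ_three] <;> simp

/-! ## §6 (ED. 2) The `θ`-STABLE complement `range (ad N⁻)` of `𝔷(N)`: the slice chart `(Y, Z) ↦ ⁅c·E₀₂, Y⁆ + Z` on `range (ad E₂₀) × 𝔷(E₂₀)`

For the descent to a real form `𝔲` containing `N = c·E₀₂` AND `N⁻ = c′·E₂₀` the complement of `𝔷(N)` must be stable under the form's involution; the canonical
choice is `range (ad N⁻)` (highest-weight theory of the `𝔰𝔩₂`-triple: `𝔤 = ker (ad e) ⊕ range (ad f)` and `ad e : range (ad f) ≅ range (ad e)`).  Entrywise: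
`range (ad E₂₀) = {A | A 0 1 = A 0 2 = A 1 1 = A 1 2 = 0, A 0 0 + A 2 2 = 0}`; `ad N` is injective there when `2` is a non-zero-divisor and onto `range (ad N)` when `2` is a unit. -/

/-- ENTRIES of `⁅E₂₀, A⁆ = E₂₀ A − A E₂₀`: row `2` receives row `0` of `A`, column `0` loses column `2` of `A`. [cite: HornJohnson2013, §0.9] -/
theorem single_two_zero_bracket_eq (c : R) (A : Matrix (Fin 3) (Fin 3) R) :
    single (2 : Fin 3) (0 : Fin 3) c * A - A * single (2 : Fin 3) (0 : Fin 3) c =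
      !![-(c * A 0 2), 0, 0; -(c * A 1 2), 0, 0; c * (A 0 0 - A 2 2), c * A 0 1, c * A 0 2] := by
  ext i j
  fin_cases i <;> fin_cases j <;> simp only [Matrix.sub_apply, Matrix.mul_apply, Fin.sum_univ_three] <;> simp <;> ring

/-- RANGE of `ad E₂₀`: every bracket `M = ⁅c·E₂₀, A⁆` has `M 0 1 = M 0 2 = M 1 1 = M 1 2 = 0` and `M 0 0 + M 2 2 = 0`. [cite: HornJohnson2013, §0.9] -/
theorem bracket_single_two_zero_mem_range (c : R) (A : Matrix (Fin 3) (Fin 3) R) :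
    (single (2 : Fin 3) (0 : Fin 3) c * A - A * single (2 : Fin 3) (0 : Fin 3) c) 0 1 = 0 ∧
      (single (2 : Fin 3) (0 : Fin 3) c * A - A * single (2 : Fin 3) (0 : Fin 3) c) 0 2 = 0 ∧
      (single (2 : Fin 3) (0 : Fin 3) c * A - A * single (2 : Fin 3) (0 : Fin 3) c) 1 1 = 0 ∧
      (single (2 : Fin 3) (0 : Fin 3) c * A - A * single (2 : Fin 3) (0 : Fin 3) c) 1 2 = 0 ∧
      (single (2 : Fin 3) (0 : Fin 3) c * A - A * single (2 : Fin 3) (0 : Fin 3) c) 0 0 +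
        (single (2 : Fin 3) (0 : Fin 3) c * A - A * single (2 : Fin 3) (0 : Fin 3) c) 2 2 = 0 := by
  rw [single_two_zero_bracket_eq]
  refine ⟨?_, ?_, ?_, ?_, ?_⟩ <;> simp

/-- A SECTION of `ad N` (`N = c·E₀₂`, `c` and `2` units) on its range, WITH VALUES IN `range (ad E₂₀)`: a matrix `M` with `M 1 0 = M 1 1 = M 2 0 = M 2 1 = 0`,
`M 0 0 + M 2 2 = 0` is `⁅c·E₀₂, A⁆` for `A = c⁻¹ · (M 0 0 E₂₀ + M 0 1 E₂₁ − M 1 2 E₁₀) + (2c)⁻¹ · M 0 2 (E₂₂ − E₀₀)`, which satisfies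
`A 0 1 = A 0 2 = A 1 1 = A 1 2 = 0`, `A 0 0 + A 2 2 = 0`. [cite: Humphreys1972, §7.2] -/
theorem exists_bracket_single_zero_two_eq_of_mem_range (c : Rˣ) (h2 : IsUnit (2 : R)) {M : Matrix (Fin 3) (Fin 3) R}
    (h10 : M 1 0 = 0) (h11 : M 1 1 = 0) (h20 : M 2 0 = 0) (h21 : M 2 1 = 0) (htr : M 0 0 + M 2 2 = 0) :
    ∃ A : Matrix (Fin 3) (Fin 3) R, (A 0 1 = 0 ∧ A 0 2 = 0 ∧ A 1 1 = 0 ∧ A 1 2 = 0 ∧ A 0 0 + A 2 2 = 0) ∧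
      single (0 : Fin 3) (2 : Fin 3) (c : R) * A - A * single (0 : Fin 3) (2 : Fin 3) (c : R) = M := by
  obtain ⟨u, hu⟩ := h2
  have hu' : (↑u : R) * ↑u⁻¹ = 1 := Units.mul_inv u
  have hu2 : (↑u : R) = 2 := hu
  refine ⟨!![-(↑c⁻¹ * (↑u⁻¹ * M 0 2)), 0, 0; -(↑c⁻¹ * M 1 2), 0, 0; ↑c⁻¹ * M 0 0, ↑c⁻¹ * M 0 1, ↑c⁻¹ * (↑u⁻¹ * M 0 2)],
    ⟨by simp, by simp, by simp, by simp, by simp⟩, ?_⟩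
  rw [single_zero_two_bracket_eq]
  ext i j
  fin_cases i <;> fin_cases j <;> simp [h10, h11, h20, h21]
  · have hc' : (↑c : R) * ↑c⁻¹ = 1 := Units.mul_inv c
    linear_combination (2 * (↑u⁻¹ * M 0 2)) * hc' + (-(↑u⁻¹ * M 0 2)) * hu2 + (M 0 2) * hu'
  · linear_combination (-1 : R) * htr

/-- INJECTIVITY of `ad N` on `range (ad E₂₀)`: if `A 0 1 = A 0 2 = A 1 1 = A 1 2 = 0`, `A 0 0 + A 2 2 = 0` and `⁅c·E₀₂, A⁆ = 0` (`c`, `2` units) then `A = 0`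
— so `ker (ad N) ∩ range (ad N⁻) = 0`. [cite: Humphreys1972, §7.2] -/
theorem eq_zero_of_mem_range_of_bracket_eq_zero {c : R} (hc : IsUnit c) (h2 : IsUnit (2 : R)) {A : Matrix (Fin 3) (Fin 3) R}
    (h01 : A 0 1 = 0) (h02 : A 0 2 = 0) (h11 : A 1 1 = 0) (h12 : A 1 2 = 0) (htr : A 0 0 + A 2 2 = 0)
    (h : single (0 : Fin 3) (2 : Fin 3) c * A - A * single (0 : Fin 3) (2 : Fin 3) c = 0) : A = 0 := by
  obtain ⟨u, hu⟩ := h2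
  rw [single_zero_two_bracket_eq] at h
  have e := fun i j => congrFun (congrFun h i) j
  have e00 := e 0 0
  have e01 := e 0 1
  have e02 := e 0 2
  have e12 := e 1 2
  simp at e00 e01 e02 e12
  have a20 : A 2 0 = 0 := hc.mul_right_eq_zero.mp e00
  have a21 : A 2 1 = 0 := hc.mul_right_eq_zero.mp e01
  have a10 : A 1 0 = 0 := hc.mul_right_eq_zero.mp e12
  -- `c (A 2 2 − A 0 0) = 0` and `A 0 0 + A 2 2 = 0` give `2 A 2 2 = 0`
  have hd : A 2 2 - A 0 0 = 0 := hc.mul_right_eq_zero.mp e02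
  have a22 : A 2 2 = 0 := by
    have h' : (↑u : R) * A 2 2 = 0 := by rw [hu]; linear_combination hd + htr
    exact (u.isUnit.mul_right_eq_zero).mp h'
  have a00 : A 0 0 = 0 := by linear_combination htr - a22
  ext i j
  fin_cases i <;> fin_cases j <;> simp [h01, h02, h11, h12, a00, a10, a20, a21, a22]

/-- TRANSVERSALITY IN SLICE FORM: every `Z` is `⁅c·E₀₂, Y⁆ + W` with `Y ∈ range (ad E₂₀)` (entrywise: `Y 0 1 = Y 0 2 = Y 1 1 = Y 1 2 = 0`, `Y 0 0 + Y 2 2 = 0`) and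
`W ∈ 𝔷(E₂₀)` (`c`, `2` units) — the chart `(Y, W) ↦ ⁅N, Y⁆ + W : range (ad N⁻) × 𝔷(N⁻) → M₃` is onto (and one-to-one by `eq_zero_of_mem_range_of_bracket_eq_zero` +
`bracket_eq_zero_of_commute_single_two_zero`). [cite: Humphreys1972, §7.2] -/
theorem exists_mem_range_bracket_add_centralizer (c : Rˣ) (h2 : IsUnit (2 : R)) (Z : Matrix (Fin 3) (Fin 3) R) :
    ∃ Y W : Matrix (Fin 3) (Fin 3) R, (Y 0 1 = 0 ∧ Y 0 2 = 0 ∧ Y 1 1 = 0 ∧ Y 1 2 = 0 ∧ Y 0 0 + Y 2 2 = 0) ∧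
      W * single (2 : Fin 3) (0 : Fin 3) (1 : R) = single (2 : Fin 3) (0 : Fin 3) 1 * W ∧
        Z = (single (0 : Fin 3) (2 : Fin 3) (c : R) * Y - Y * single (0 : Fin 3) (2 : Fin 3) (c : R)) + W := by
  obtain ⟨A, W, hW, hZ, -, -, -, -, -, -⟩ := exists_bracket_add_centralizer c h2 Z
  -- the range component `⁅N, A⁆` has a preimage `Y` in `range (ad E₂₀)`
  obtain ⟨h10, h11, h20, h21, htr⟩ := bracket_single_zero_two_mem_range (c : R) A
  obtain ⟨Y, hY, hYM⟩ := exists_bracket_single_zero_two_eq_of_mem_range c h2 h10 h11 h20 h21 htr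
  exact ⟨Y, W, hY, hW, by rw [hYM]; exact hZ⟩

/-! ## §7 (ED. 3) The slice `N + 𝔷(E₂₀)` meets the square-zero locus only at the vertex, carries no scalar, and its non-regular points are of type `(a,a,b)`
(field `K`, `2 ≠ 0`; `3 ≠ 0` for the trace-zero statement) — rider of the road holder (F0P2-p01, 2026-09-02 16:24Z) for D5(iii): every shell point of the
weighted cone on the slice is either regular (★ D4a `LinearIndependent K ![1, X, X²]`) or semisimple of type `(a,a,b)`, never nilpotent-shifted or scalar. -/

section SliceLocus

variable {K : Type*} [Field K]

/-- **NO SCALAR ON THE SLICE**: `c·E₀₂ + Z ≠ a • 1` for `Z ∈ 𝔷(E₂₀)` (the `(0,2)` entry of the slice point is `c ≠ 0`). [cite: Humphreys1972, §7.2] -/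
theorem single_zero_two_add_ne_smul_one {c : K} (hc : c ≠ 0) {Z : Matrix (Fin 3) (Fin 3) K}
    (hZ : Z * single (2 : Fin 3) (0 : Fin 3) (1 : K) = single (2 : Fin 3) (0 : Fin 3) 1 * Z) (a : K) :
    single (0 : Fin 3) (2 : Fin 3) c + Z ≠ a • (1 : Matrix (Fin 3) (Fin 3) K) := by
  obtain ⟨-, h02, -, -⟩ := (commute_single_two_zero_iff Z).mp hZ
  intro h
  have e := congrFun (congrFun h 0) 2
  simp [h02] at e
  exact hc e

/-- THE SQUARE OF A SLICE POINT, entrywise: for `Z ∈ 𝔷(E₂₀)` (`Z = !![a,0,0; d,e,0; f,g,a]`),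
`(c·E₀₂ + Z)² = !![a² + cf, cg, 2ca; da + ed, e², dc; 2af + gd, ge + ag, cf + a²]`. [cite: Humphreys1972, §7.2] -/
theorem single_zero_two_add_mul_self_eq {S : Type*} [CommRing S] (c : S) {Z : Matrix (Fin 3) (Fin 3) S}
    (hZ : Z * single (2 : Fin 3) (0 : Fin 3) (1 : S) = single (2 : Fin 3) (0 : Fin 3) 1 * Z) :
    (single (0 : Fin 3) (2 : Fin 3) c + Z) * (single (0 : Fin 3) (2 : Fin 3) c + Z) =
      !![Z 0 0 ^ 2 + c * Z 2 0, c * Z 2 1, 2 * c * Z 0 0;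
         Z 1 0 * Z 0 0 + Z 1 1 * Z 1 0, Z 1 1 ^ 2, Z 1 0 * c;
         2 * Z 0 0 * Z 2 0 + Z 2 1 * Z 1 0, Z 2 1 * Z 1 1 + Z 0 0 * Z 2 1, c * Z 2 0 + Z 0 0 ^ 2] := by
  obtain ⟨h01, h02, h12, h0022⟩ := (commute_single_two_zero_iff Z).mp hZ
  ext i j
  fin_cases i <;> fin_cases j <;> simp only [Matrix.mul_apply, Matrix.add_apply, Fin.sum_univ_three] <;> simp [h01, h02, h12, h0022] <;> ring

/-- **THE SLICE MEETS THE SQUARE-ZERO LOCUS ONLY AT THE VERTEX**: if `Z ∈ 𝔷(E₂₀)` and `(c·E₀₂ + Z)² = 0` (`c ≠ 0`, `2 ≠ 0`) then `Z = 0`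
(entries of the square: `Z₁₁²`, `c·Z₂₁`, `c·Z₁₀`, `2c·Z₀₀`, then `Z₀₀² + c·Z₂₀`). [cite: Humphreys1972, §7.2] -/
theorem eq_zero_of_single_zero_two_add_sq_eq_zero {c : K} (hc : c ≠ 0) (h2 : (2 : K) ≠ 0) {Z : Matrix (Fin 3) (Fin 3) K}
    (hZ : Z * single (2 : Fin 3) (0 : Fin 3) (1 : K) = single (2 : Fin 3) (0 : Fin 3) 1 * Z)
    (h : (single (0 : Fin 3) (2 : Fin 3) c + Z) * (single (0 : Fin 3) (2 : Fin 3) c + Z) = 0) : Z = 0 := by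
  obtain ⟨h01, h02, h12, h0022⟩ := (commute_single_two_zero_iff Z).mp hZ
  rw [single_zero_two_add_mul_self_eq c hZ] at h
  have e11 : Z 1 1 = 0 := by simpa using congrFun (congrFun h 1) 1
  have e01 : Z 2 1 = 0 := by simpa [hc] using congrFun (congrFun h 0) 1
  have e12 : Z 1 0 = 0 := by simpa [hc] using congrFun (congrFun h 1) 2
  have e02 : Z 0 0 = 0 := by simpa [hc, h2] using congrFun (congrFun h 0) 2
  have e00 : Z 2 0 = 0 := by simpa [hc, e02] using congrFun (congrFun h 0) 0
  ext i j
  fin_cases i <;> fin_cases j <;> simp [h01, h02, h12, ← h0022, e11, e01, e12, e02, e00]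

/-- **NON-REGULAR SLICE POINTS ARE SEMISIMPLE OF TYPE `(a,a,b)`**: on the TRACE-ZERO slice (`trace (c·E₀₂ + Z) = 0`, `Z ∈ 𝔷(E₂₀)`, `Z ≠ 0`; `2, 3 ≠ 0`) an annihilating
relation `(X − a•1)(X − b•1) = 0` forces `a ≠ b` and `X` non-scalar — the third branch of ★ `nonregular_trichotomy` (so ★ `spectralProj_*` apply).
[cite: Humphreys1972, §7.2] -/
theorem ne_and_not_scalar_of_slice_nonregular {c : K} (hc : c ≠ 0) (h2 : (2 : K) ≠ 0) (h3 : (3 : K) ≠ 0) {Z : Matrix (Fin 3) (Fin 3) K}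
    (hZ : Z * single (2 : Fin 3) (0 : Fin 3) (1 : K) = single (2 : Fin 3) (0 : Fin 3) 1 * Z) (hZ0 : Z ≠ 0)
    (htr : Matrix.trace (single (0 : Fin 3) (2 : Fin 3) c + Z) = 0) {a b : K}
    (hab : (single (0 : Fin 3) (2 : Fin 3) c + Z - a • (1 : Matrix (Fin 3) (Fin 3) K)) * (single (0 : Fin 3) (2 : Fin 3) c + Z - b • 1) = 0) :
    a ≠ b ∧ ∀ a' : K, single (0 : Fin 3) (2 : Fin 3) c + Z ≠ a' • 1 := by
  refine ⟨?_, single_zero_two_add_ne_smul_one hc hZ⟩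
  rintro rfl
  -- `a = b`: `(N + (Z − a•1))² = 0` with `Z − a•1 ∈ 𝔷(E₂₀)` ⇒ `Z = a•1`, then `trace = 3a = 0` ⇒ `a = 0` ⇒ `Z = 0`
  have hZ' : (Z - a • (1 : Matrix (Fin 3) (Fin 3) K)) * single (2 : Fin 3) (0 : Fin 3) (1 : K) =
      single (2 : Fin 3) (0 : Fin 3) 1 * (Z - a • (1 : Matrix (Fin 3) (Fin 3) K)) := by
    rw [sub_mul, mul_sub, hZ, Matrix.smul_mul, Matrix.mul_smul, Matrix.one_mul, Matrix.mul_one]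
  have hsq : (single (0 : Fin 3) (2 : Fin 3) c + (Z - a • 1)) * (single (0 : Fin 3) (2 : Fin 3) c + (Z - a • 1)) = 0 := by
    rw [← add_sub_assoc]
    exact hab
  have hZa : Z = a • 1 := sub_eq_zero.mp (eq_zero_of_single_zero_two_add_sq_eq_zero hc h2 hZ' hsq)
  have htr' : Matrix.trace (single (0 : Fin 3) (2 : Fin 3) c + Z) = 3 * a := by
    rw [hZa, Matrix.trace_fin_three]
    simp
    ring
  rw [htr'] at htr
  rcases mul_eq_zero.mp htr with h' | h'
  · exact h3 h'
  · apply hZ0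
    rw [hZa, h', zero_smul]

end SliceLocus

end Literature.LinearAlgebra.Matrix

end
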